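import Literature.NumberTheory.LFunctions.GaussianHeckeDivisorMoments
import Literature.NumberTheory.QuadraticFields.GaussianNormCount
import Mathlib.Data.Finset.NatDivisors
import HarnessLib

/-!
# The content-weighted second moment of the divisor function on `ℤ[i]*`

Topic `Literature/NumberTheory/LFunctions`.  Everything in this file is PROVED; no definitions, no named
facts.  The mean value theorem for Hecke polynomials of `ℚ(i)` carries the weight `g(v) √(N/N(v))` with
`g(v)` the content of `v`; feeding it the mollified coefficients (`|b_v| ≤ τ⋆(v) = #divisorsStar v`) in the
class-I count of the zero-detection method requires

  `GaussianHecke.sum_content_mul_card_divisorsStar_sq_le`: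
  `∑_{v ∈ ℤ[i]*, N(v) ≤ y} g(v) τ⋆(v)² ≤ 12266496 · y (1 + log y)^259`  (`y ≥ 1`).

Only a power of `log y` matters downstream, so the proof is deliberately crude: writing `v = g v₀`
(`g = g(v)`, `v₀ ∈ ℤ[i]*`, `N(v₀) ≤ y/g²`) and using `τ⋆(g v₀) ≤ τ⋆(g) τ⋆(v₀)`
(`card_divisorsStar_mul_le`) and `∑_{N(w) ≤ y'} τ⋆(w)² ≤ 766656 y' (1 + log y')³`
(`sum_card_divisorsStar_sq_le`) leaves `∑_{g ≤ √y} τ⋆(g)²/g`; for a rational integer `g`,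
`τ⋆(g) ≤ ∑_{n ∣ g²} r(n) ≤ 4 d(g²)² ≤ 4 d(g)⁴` (`r(n) ≤ 4 d(n)`, `GaussianPrimary.card_normEq_le`), and the
rational moments `D_k(E) = ∑_{e ≤ E} d(e)^k/e` satisfy `D_{k+1} ≤ D_k²` (from `d(e)^{k+1} = ∑_{ab=e} d(ab)^k ≤
∑_{ab=e} d(a)^k d(b)^k`) and `D_0 ≤ 1 + log E`, whence `D_8 ≤ (1 + log E)^256`.

## References

* H. L. Montgomery, *Topics in Multiplicative Number Theory*, LNM 227 (1971), Ch. 12. [Montgomery1971]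
* G. H. Hardy, E. M. Wright, *An Introduction to the Theory of Numbers*, Thm 278, §18.2. [HardyWright]
-/

noncomputable section

open Finset UniqueFactorizationMonoid

namespace Literature.NumberTheory.LFunctions

namespace GaussianHecke

open GaussianInt GaussianTheta

/-! ### Rational divisor moments -/

/-- `d(ab) ≤ d(a) d(b)`. [folklore] -/
theorem card_divisors_mul_le (a b : ℕ) : (a * b).divisors.card ≤ a.divisors.card * b.divisors.card := by
  rw [Nat.divisors_mul]; exact card_mul_le

/-- `#{(a,b) : ab = e} = d(e)`. [folklore] -/
theorem card_divisorsAntidiagonal_eq (e : ℕ) : e.divisorsAntidiagonal.card = e.divisors.card := by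
  rw [← Nat.map_div_right_divisors, card_map]

/-- `d(e)^{k+1} ≤ ∑_{ab = e} d(a)^k d(b)^k`. [folklore] -/
theorem card_divisors_pow_succ_le (e k : ℕ) :
    ((e.divisors.card : ℝ)) ^ (k + 1) ≤
      ∑ p ∈ e.divisorsAntidiagonal, ((p.1.divisors.card : ℝ)) ^ k * ((p.2.divisors.card : ℝ)) ^ k := by
  have h1 : ((e.divisors.card : ℝ)) ^ (k + 1) =
      ∑ _p ∈ e.divisorsAntidiagonal, ((e.divisors.card : ℝ)) ^ k := by
    rw [sum_const, nsmul_eq_mul, card_divisorsAntidiagonal_eq, pow_succ, mul_comm]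
  rw [h1]
  refine sum_le_sum fun p hp ↦ ?_
  have hp' := (Nat.mem_divisorsAntidiagonal.1 hp).1
  rw [← mul_pow]
  refine pow_le_pow_left₀ (Nat.cast_nonneg _) ?_ k
  rw [← hp']
  exact_mod_cast card_divisors_mul_le p.1 p.2

/-- `D_{k+1}(E) ≤ D_k(E)²` for `D_k(E) = ∑_{1 ≤ e ≤ E} d(e)^k / e`. [folklore] -/
theorem divisorMoment_succ_le (E k : ℕ) :
    ∑ e ∈ Icc 1 E, ((e.divisors.card : ℝ)) ^ (k + 1) / e ≤
      (∑ e ∈ Icc 1 E, ((e.divisors.card : ℝ)) ^ k / e) ^ 2 := by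
  set f : ℕ → ℝ := fun a ↦ ((a.divisors.card : ℝ)) ^ k / a with hf
  have hf0 : ∀ a, 0 ≤ f a := fun a ↦ by simp only [hf]; positivity
  calc ∑ e ∈ Icc 1 E, ((e.divisors.card : ℝ)) ^ (k + 1) / e
      ≤ ∑ e ∈ Icc 1 E, ∑ p ∈ e.divisorsAntidiagonal, f p.1 * f p.2 := by
        refine sum_le_sum fun e he ↦ ?_
        have he1 : (1 : ℝ) ≤ e := by exact_mod_cast (mem_Icc.1 he).1
        rw [div_le_iff₀ (by linarith), sum_mul]
        refine (card_divisors_pow_succ_le e k).trans (le_of_eq (sum_congr rfl fun p hp ↦ ?_))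
        obtain ⟨hp', he0⟩ := Nat.mem_divisorsAntidiagonal.1 hp
        have h1 : p.1 ≠ 0 := by rintro h; rw [h, zero_mul] at hp'; exact he0 hp'.symm
        have h2 : p.2 ≠ 0 := by rintro h; rw [h, mul_zero] at hp'; exact he0 hp'.symm
        have h1' : (p.1 : ℝ) ≠ 0 := by exact_mod_cast h1
        have h2' : (p.2 : ℝ) ≠ 0 := by exact_mod_cast h2
        simp only [hf]
        rw [← hp', Nat.cast_mul]
        field_simp
    _ = ∑ q ∈ (Icc 1 E).sigma (fun e ↦ e.divisorsAntidiagonal), f q.2.1 * f q.2.2 :=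
        (sum_sigma (Icc 1 E) (fun e ↦ e.divisorsAntidiagonal) (fun q ↦ f q.2.1 * f q.2.2)).symm
    _ = ∑ p ∈ ((Icc 1 E).sigma (fun e ↦ e.divisorsAntidiagonal)).image (fun q ↦ q.2), f p.1 * f p.2 := by
        rw [sum_image]
        intro q hq q' hq' h
        rw [mem_coe, mem_sigma] at hq hq'
        have h1 := (Nat.mem_divisorsAntidiagonal.1 hq.2).1
        have h2 := (Nat.mem_divisorsAntidiagonal.1 hq'.2).1
        have h' : q.2 = q'.2 := h
        have he : q.1 = q'.1 := by rw [← h1, ← h2, h']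
        exact Sigma.ext he (heq_of_eq h')
    _ ≤ ∑ p ∈ Icc 1 E ×ˢ Icc 1 E, f p.1 * f p.2 := by
        refine sum_le_sum_of_subset_of_nonneg (fun p hp ↦ ?_) (fun p _ _ ↦ mul_nonneg (hf0 _) (hf0 _))
        rw [mem_image] at hp
        obtain ⟨q, hq, rfl⟩ := hp
        rw [mem_sigma] at hq
        obtain ⟨he, hq2⟩ := hq
        obtain ⟨hp', he0⟩ := Nat.mem_divisorsAntidiagonal.1 hq2
        rw [mem_Icc] at he
        rw [mem_product, mem_Icc, mem_Icc]
        have h1 : q.2.1 ∣ q.1 := ⟨q.2.2, hp'.symm⟩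
        have h2 : q.2.2 ∣ q.1 := ⟨q.2.1, by rw [mul_comm]; exact hp'.symm⟩
        have hq0 : 0 < q.1 := by omega
        exact ⟨⟨Nat.pos_of_dvd_of_pos h1 hq0, (Nat.le_of_dvd hq0 h1).trans he.2⟩,
          ⟨Nat.pos_of_dvd_of_pos h2 hq0, (Nat.le_of_dvd hq0 h2).trans he.2⟩⟩
    _ = (∑ e ∈ Icc 1 E, f e) ^ 2 := by rw [sq, sum_mul_sum, sum_product]

/-- `D_k(E) ≤ (1 + log E)^{2^k}`. [folklore] -/
theorem divisorMoment_le (E k : ℕ) :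
    ∑ e ∈ Icc 1 E, ((e.divisors.card : ℝ)) ^ k / e ≤ (1 + Real.log E) ^ (2 ^ k) := by
  induction k with
  | zero =>
    have hh := harmonic_le_one_add_log E
    rw [harmonic_eq_sum_Icc] at hh
    push_cast at hh
    simpa [one_div] using hh
  | succ k ih =>
    have h0 : 0 ≤ ∑ e ∈ Icc 1 E, ((e.divisors.card : ℝ)) ^ k / e := sum_nonneg fun e _ ↦ by positivity
    calc ∑ e ∈ Icc 1 E, ((e.divisors.card : ℝ)) ^ (k + 1) / e
        ≤ (∑ e ∈ Icc 1 E, ((e.divisors.card : ℝ)) ^ k / e) ^ 2 := divisorMoment_succ_le E k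
      _ ≤ ((1 + Real.log E) ^ (2 ^ k)) ^ 2 := pow_le_pow_left₀ h0 ih 2
      _ = (1 + Real.log E) ^ (2 ^ (k + 1)) := by rw [← pow_mul, pow_succ]

/-! ### Gaussian divisors of a rational integer -/

/-- `τ⋆(e) ≤ 4 d(e)⁴` for a rational integer `e ≥ 1`: every first-quadrant divisor of `e` has norm dividing
`e²`, `r(n) ≤ 4 d(n) ≤ 4 d(e²)` for `n ∣ e²`, and `d(e²) ≤ d(e)²`. [folklore] -/
theorem card_divisorsStar_natCast_le {e : ℕ} (he : e ≠ 0) :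
    (divisorsStar (e : _root_.GaussianInt)).card ≤ 4 * e.divisors.card ^ 4 := by
  have he0 : (e : _root_.GaussianInt) ≠ 0 := by exact_mod_cast he
  have hsub : divisorsStar (e : _root_.GaussianInt) ⊆ (e ^ 2).divisors.biUnion (fun n ↦ normEq n) := by
    intro d hd
    rw [mem_divisorsStar he0] at hd
    obtain ⟨-, c, hc⟩ := hd
    rw [mem_biUnion]
    refine ⟨d.norm.natAbs, ?_, ?_⟩
    · rw [Nat.mem_divisors]
      refine ⟨?_, pow_ne_zero 2 he⟩
      have h1 : ((e : _root_.GaussianInt)).norm = d.norm * c.norm := by rw [hc, Zsqrtd.norm_mul]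
      rw [Zsqrtd.norm_natCast] at h1
      have h2 : d.norm ∣ (e : ℤ) * e := ⟨c.norm, h1⟩
      have h3 := Int.natAbs_dvd_natAbs.2 h2
      rwa [Int.natAbs_mul, Int.natAbs_natCast, ← pow_two] at h3
    · rw [mem_normEq]
      exact (Int.natAbs_of_nonneg (GaussianInt.norm_nonneg d)).symm
  calc (divisorsStar (e : _root_.GaussianInt)).card
      ≤ ((e ^ 2).divisors.biUnion (fun n ↦ normEq n)).card := card_le_card hsub
    _ ≤ ∑ n ∈ (e ^ 2).divisors, (normEq n).card := card_biUnion_le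
    _ ≤ ∑ n ∈ (e ^ 2).divisors, 4 * (e ^ 2).divisors.card := by
        refine sum_le_sum fun n hn ↦ ?_
        obtain ⟨hdvd, hne⟩ := Nat.mem_divisors.1 hn
        have hn0 : n ≠ 0 := by rintro rfl; exact hne (by simpa using hdvd)
        exact (_root_.Literature.NumberTheory.QuadraticFields.GaussianPrimary.card_normEq_le n hn0).trans
          (Nat.mul_le_mul_left 4 (card_le_card (Nat.divisors_subset_of_dvd hne hdvd)))
    _ = 4 * (e ^ 2).divisors.card ^ 2 := by rw [sum_const, smul_eq_mul]; ring
    _ ≤ 4 * (e.divisors.card ^ 2) ^ 2 := by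
        have : (e ^ 2).divisors.card ≤ e.divisors.card ^ 2 := by
          rw [pow_two, pow_two]; exact card_divisors_mul_le e e
        gcongr
    _ = 4 * e.divisors.card ^ 4 := by ring

/-! ### The content-weighted second moment -/

/-- **`∑_{v ∈ ℤ[i]*, N(v) ≤ y} g(v) τ⋆(v)² ≤ 12266496 · y (1 + log y)^259`** for `y ≥ 1` (see the module
docstring). [folklore] -/
theorem sum_content_mul_card_divisorsStar_sq_le {y : ℝ} (hy : 1 ≤ y) :
    ∑ v ∈ normLEStar y, (GaussianInt.content v : ℝ) * ((divisorsStar v).card : ℝ) ^ 2 ≤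
      12266496 * y * (1 + Real.log y) ^ 259 := by
  have hy0 : 0 ≤ y := by linarith
  set L := 1 + Real.log y with hL
  have hL1 : 1 ≤ L := by rw [hL]; linarith [Real.log_nonneg hy]
  set E : ℕ := ⌊Real.sqrt y⌋₊ with hE
  have hsqrt1 : 1 ≤ Real.sqrt y := by simpa using Real.one_le_sqrt.2 hy
  have hE1 : 1 ≤ E := by
    rw [hE]; exact Nat.le_floor (by simpa using hsqrt1)
  have hEy : (E : ℝ) ≤ y := by
    refine (Nat.floor_le (Real.sqrt_nonneg y)).trans ?_
    rw [Real.sqrt_le_left hy0]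
    nlinarith
  -- fibre by the content, which lies in `[1, ⌊√y⌋]`
  have hmaps : ∀ v ∈ normLEStar y, GaussianInt.content v ∈ Icc 1 E := by
    intro v hv
    rw [mem_normLEStar] at hv
    have hvq := hv.2
    rw [mem_firstQuadrant] at hvq
    have hcpos : 0 < GaussianInt.content v := Int.gcd_pos_of_ne_zero_left _ hvq.1.ne'
    rw [mem_Icc]
    refine ⟨hcpos, Nat.le_floor ?_⟩
    have hdec := eq_content_mul v
    set v₀ : _root_.GaussianInt := ⟨v.re / GaussianInt.content v, v.im / GaussianInt.content v⟩
    have hnorm : ((GaussianInt.content v : ℤ)) ^ 2 * v₀.norm = v.norm := by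
      conv_rhs => rw [hdec]
      rw [norm_natCast_mul]
    have hv₀0 : v₀ ≠ 0 := by
      intro h0; rw [h0, mul_zero] at hdec; exact ne_zero_of_mem_fq hv.2 hdec
    have hN₀ : 1 ≤ v₀.norm := by have := GaussianInt.norm_pos.2 hv₀0; omega
    have hsq : ((GaussianInt.content v : ℤ)) ^ 2 ≤ v.norm := by nlinarith
    have hsqR : ((GaussianInt.content v : ℝ)) ^ 2 ≤ y := by
      have : (((GaussianInt.content v : ℤ) : ℝ)) ^ 2 ≤ (v.norm : ℝ) := by exact_mod_cast hsq
      push_cast at this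
      linarith [hv.1]
    exact (le_abs_self _).trans (Real.abs_le_sqrt hsqR)
  -- the fibre of content `e`
  have hfib : ∀ e ∈ Icc 1 E, ∑ v ∈ (normLEStar y).filter (fun v ↦ GaussianInt.content v = e),
      (GaussianInt.content v : ℝ) * ((divisorsStar v).card : ℝ) ^ 2 ≤
        16 * 766656 * y * L ^ 3 * (((e.divisors.card : ℝ)) ^ 8 / e) := by
    intro e he
    rw [mem_Icc] at he
    have he1 : 1 ≤ e := he.1
    have he0 : (0 : ℝ) < e := by exact_mod_cast he1
    have heE : (e : ℝ) ≤ Real.sqrt y := by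
      have : (e : ℝ) ≤ E := by exact_mod_cast he.2
      exact this.trans (Nat.floor_le (Real.sqrt_nonneg y))
    have he2y : (e : ℝ) ^ 2 ≤ y := by
      calc (e : ℝ) ^ 2 ≤ (Real.sqrt y) ^ 2 := pow_le_pow_left₀ he0.le heE 2
        _ = y := Real.sq_sqrt hy0
    set y' : ℝ := y / (e : ℝ) ^ 2 with hy'
    have hy'1 : 1 ≤ y' := by rw [hy', le_div_iff₀ (by positivity)]; linarith
    set φ : _root_.GaussianInt → _root_.GaussianInt := fun v ↦ ⟨v.re / e, v.im / e⟩ with hφ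
    set S := (normLEStar y).filter (fun v ↦ GaussianInt.content v = e) with hS
    have hSv : ∀ v ∈ S, v = (e : _root_.GaussianInt) * φ v ∧ φ v ∈ normLEStar y' ∧ φ v ≠ 0 := by
      intro v hv
      rw [hS, mem_filter, mem_normLEStar] at hv
      obtain ⟨⟨hvy, hvq⟩, hve⟩ := hv
      have hdec0 := eq_content_mul v
      rw [hve] at hdec0
      have hdec : v = (e : _root_.GaussianInt) * φ v := hdec0
      have hnorm : ((e : ℤ)) ^ 2 * (φ v).norm = v.norm := by
        conv_rhs => rw [hdec]
        rw [norm_natCast_mul]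
      have hv₀0 : φ v ≠ 0 := by
        intro h0; rw [h0, mul_zero] at hdec; exact ne_zero_of_mem_fq hvq hdec
      refine ⟨hdec, ?_, hv₀0⟩
      rw [mem_normLEStar]
      constructor
      · rw [hy', le_div_iff₀ (by positivity)]
        have : ((φ v).norm : ℝ) * (e : ℝ) ^ 2 = (v.norm : ℝ) := by
          have := congrArg (fun z : ℤ ↦ (z : ℝ)) hnorm
          push_cast at this
          linarith
        linarith
      · rw [mem_firstQuadrant] at hvq ⊢
        have hre : v.re = (e : ℤ) * (φ v).re := by
          have := congrArg Zsqrtd.re hdec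
          rw [(natCast_mul_re_im e (φ v)).1] at this; exact this
        have him : v.im = (e : ℤ) * (φ v).im := by
          have := congrArg Zsqrtd.im hdec
          rw [(natCast_mul_re_im e (φ v)).2] at this; exact this
        have he' : (0 : ℤ) < e := by exact_mod_cast he1
        constructor
        · by_contra hc; rw [not_lt] at hc; nlinarith [hvq.1]
        · by_contra hc; rw [not_le] at hc; nlinarith [hvq.2]
    have hinj : Set.InjOn φ ↑S := by
      intro v hv v' hv' heq
      rw [mem_coe] at hv hv'
      rw [(hSv v hv).1, (hSv v' hv').1, heq]
    have hτe : ((divisorsStar (e : _root_.GaussianInt)).card : ℝ) ≤ 4 * (e.divisors.card : ℝ) ^ 4 := by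
      exact_mod_cast card_divisorsStar_natCast_le (by omega : e ≠ 0)
    have hee0 : (e : _root_.GaussianInt) ≠ 0 := by exact_mod_cast (by omega : e ≠ 0)
    have hlog : 1 + Real.log y' ≤ L := by
      rw [hL, hy']
      have h1e : (1 : ℝ) ≤ (e : ℝ) ^ 2 := one_le_pow₀ (by exact_mod_cast he1)
      have : Real.log (y / (e : ℝ) ^ 2) ≤ Real.log y := Real.log_le_log (by positivity) (div_le_self hy0 h1e)
      linarith
    have hlog0 : 0 ≤ 1 + Real.log y' := by linarith [Real.log_nonneg hy'1]
    calc ∑ v ∈ S, (GaussianInt.content v : ℝ) * ((divisorsStar v).card : ℝ) ^ 2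
        ≤ ∑ v ∈ S, (e : ℝ) * ((4 * (e.divisors.card : ℝ) ^ 4) * ((divisorsStar (φ v)).card : ℝ)) ^ 2 := by
          refine sum_le_sum fun v hv ↦ ?_
          obtain ⟨hdec, -, hv0⟩ := hSv v hv
          have hce : (GaussianInt.content v : ℝ) = e := by
            rw [hS, mem_filter] at hv; exact_mod_cast hv.2
          rw [hce]
          refine mul_le_mul_of_nonneg_left (pow_le_pow_left₀ (Nat.cast_nonneg _) ?_ 2) he0.le
          have h1 : (divisorsStar v).card ≤
              (divisorsStar (e : _root_.GaussianInt)).card * (divisorsStar (φ v)).card := by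
            conv_lhs => rw [hdec]
            exact card_divisorsStar_mul_le hee0 hv0
          calc ((divisorsStar v).card : ℝ)
              ≤ (divisorsStar (e : _root_.GaussianInt)).card * (divisorsStar (φ v)).card := by exact_mod_cast h1
            _ ≤ 4 * (e.divisors.card : ℝ) ^ 4 * (divisorsStar (φ v)).card :=
                mul_le_mul_of_nonneg_right hτe (Nat.cast_nonneg _)
      _ = 16 * e * (e.divisors.card : ℝ) ^ 8 * ∑ v ∈ S, ((divisorsStar (φ v)).card : ℝ) ^ 2 := by
          rw [mul_sum]; exact sum_congr rfl fun v _ ↦ by ring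
      _ ≤ 16 * e * (e.divisors.card : ℝ) ^ 8 * ∑ w ∈ normLEStar y', ((divisorsStar w).card : ℝ) ^ 2 := by
          refine mul_le_mul_of_nonneg_left ?_ (by positivity)
          rw [← sum_image (f := fun w ↦ ((divisorsStar w).card : ℝ) ^ 2) hinj]
          refine sum_le_sum_of_subset_of_nonneg (fun w hw ↦ ?_) (fun w _ _ ↦ by positivity)
          rw [mem_image] at hw
          obtain ⟨v, hv, rfl⟩ := hw
          exact (hSv v hv).2.1
      _ ≤ 16 * e * (e.divisors.card : ℝ) ^ 8 * (766656 * y' * (1 + Real.log y') ^ 3) :=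
          mul_le_mul_of_nonneg_left (sum_card_divisorsStar_sq_le hy'1) (by positivity)
      _ = 16 * 766656 * ((e : ℝ) * y') * (e.divisors.card : ℝ) ^ 8 * (1 + Real.log y') ^ 3 := by ring
      _ ≤ 16 * 766656 * ((e : ℝ) * y') * (e.divisors.card : ℝ) ^ 8 * L ^ 3 :=
          mul_le_mul_of_nonneg_left (pow_le_pow_left₀ hlog0 hlog 3) (by positivity)
      _ = 16 * 766656 * y * L ^ 3 * (((e.divisors.card : ℝ)) ^ 8 / e) := by
          have e1 : (e : ℝ) * y' = y / e := by rw [hy']; field_simp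
          rw [e1]; ring
  rw [← sum_fiberwise_of_maps_to hmaps]
  have hE0 : (0 : ℝ) < E := by exact_mod_cast hE1
  have hlogE : 1 + Real.log E ≤ L := by
    rw [hL]; linarith [Real.log_le_log hE0 hEy]
  have hlogE0 : 0 ≤ 1 + Real.log E := by
    have : (1 : ℝ) ≤ E := by exact_mod_cast hE1
    linarith [Real.log_nonneg this]
  have hD := divisorMoment_le E 8
  norm_num at hD
  calc ∑ e ∈ Icc 1 E, ∑ v ∈ (normLEStar y).filter (fun v ↦ GaussianInt.content v = e),
        (GaussianInt.content v : ℝ) * ((divisorsStar v).card : ℝ) ^ 2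
      ≤ ∑ e ∈ Icc 1 E, 16 * 766656 * y * L ^ 3 * (((e.divisors.card : ℝ)) ^ 8 / e) := sum_le_sum hfib
    _ = 16 * 766656 * y * L ^ 3 * ∑ e ∈ Icc 1 E, ((e.divisors.card : ℝ)) ^ 8 / e := by rw [mul_sum]
    _ ≤ 16 * 766656 * y * L ^ 3 * (1 + Real.log E) ^ 256 := mul_le_mul_of_nonneg_left hD (by positivity)
    _ ≤ 16 * 766656 * y * L ^ 3 * L ^ 256 :=
        mul_le_mul_of_nonneg_left (pow_le_pow_left₀ hlogE0 hlogE 256) (by positivity)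
    _ = 12266496 * y * L ^ 259 := by ring

end GaussianHecke

end Literature.NumberTheory.LFunctions
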